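import Mathlib.Analysis.Complex.Exponential
import Summits.Ventures.CertifiedManyBodySolver.Downfold.PressureAxisBox
import HarnessLib

/-!
# The (b)-margin and guard tests in CLOSED RATIONAL FORM — a certified cubic bound for `e^x`, the
# decisions, and the kernel-checked margins of the P-INTERVALS rows of record

Venture CertifiedManyBodySolver, cell `pub/hubbard-downfold` (S1 = downfolding front end = ROUTER),
seat hubbard-downfold-mod-2; namespace `Summit.Ventures.CertifiedManyBodySolver.Downfold.Inflation`.
`PressureAxisBox` §2 proves the (b)-MARGIN TEST («hull_hi · e^(S·L/2) < θ ⇒ the guard window holds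
on the whole sub-interval») and the one-sided GUARD TEST with the exponential left symbolic. Every
interval row of `router/P-INTERVALS.md` prints that arithmetic with a decimal `e^x` («0.27 ×
e^(1.2·0.209) = 0.35 < 0.6» decided; «0.50 × e^(1.2·0.307) = 0.72 ≥ 0.6» undetermined); mod-1's
`router.py paxis` replays it in floating point. This file makes the test EXACT:

* §1 `expUB x = 1 + x + x²/2 + 2x³/9`, `exp_le_expUB` — a certified upper bound for `e^x` on
  `[0, 1]` (Mathlib `Real.exp_bound'` at order 3; e.g. `expUB 0.25 = 1.2847…` vs
  `e^0.25 = 1.2840…`); the lower bound `1 − x ≤ e^(−x)` is Mathlib's `Real.add_one_le_exp`.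
* §2 THE DECISIONS: `exp_lt_on_Icc_of_expUB_test` (two-sided: `max h₁ h₂ · expUB (S L / 2) < θ`,
  `S L / 2 ≤ 1` ⇒ the upper guard `X < θ` holds on `[a, b]`), `exp_lt_on_Icc_of_expUB_end_test`
  (one-sided reach: `h · expUB (S ℓ) < θ`), `lt_exp_on_Icc_of_linear_test` (lower guard:
  `θ < min l₁ l₂ · (1 − S L / 2)`) — rational inequalities a `norm_num` line checks.
* §3 KERNEL-CHECKED MARGINS OF RECORD (numbers from the records; `S_(U/t) = 2.4` = the R3c class of
  `router/INFLATION-RULES.md` §P.7; `L = |ln(V_i/V_j)|` from the record volumes, rounded UP):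
  Lu M101 (88,174) on the fcc-parent pair DECIDED (`lu_88_174_test`: `0.27 · expUB (1.2·0.209) <
  0.6`); Lu (0.8,22) and (22,88) tests FAIL (`lu_0p8_22_test_fails`, `lu_0p8_22_padded_hull_ge`,
  `lu_22_88_padded_hull_ge` — with the TRUE exponential too, via `e^x ≥ 1 + x`; the rows are
  «undetermined» by margin); V M102 (30,60) decided (`v_30_60_test`) and (0,30) failing
  (`v_0_30_padded_hull_ge`); the lead's R-dq GRID-CURE pre-registrations for V @10/@20 as exact tests on
  the pre-registered inputs (`v_0_10_prereg_test`, …) — when the columns land the inputs, not the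
  arithmetic, are what can change.

Everything is PROVED. WHAT THIS IS NOT: a claim about any material — the records' guards, the class
`S` and the volumes are SYSTEMATIC (screening-grade) inputs; a passing test certifies the
IMPLICATION «inputs ⇒ word on the interval», a failing test certifies nothing about the material
(it withholds the word).
-/

open Set

namespace Summit.Ventures.CertifiedManyBodySolver.Downfold

namespace Inflation

/-! ## §1 A certified cubic upper bound for the exponential on `[0, 1]` -/

/-- The cubic upper bound `1 + x + x²/2 + 2x³/9` for `e^x` on `[0, 1]` (order-3 Taylor polynomial plus
Mathlib's remainder bound `x³ · 4 / (3! · 3)`). [folklore] -/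
noncomputable def expUB (x : ℝ) : ℝ := 1 + x + x ^ 2 / 2 + 2 * x ^ 3 / 9

/-- `e^x ≤ expUB x` for `0 ≤ x ≤ 1`. [folklore] -/
theorem exp_le_expUB {x : ℝ} (h0 : 0 ≤ x) (h1 : x ≤ 1) : Real.exp x ≤ expUB x := by
  have h := Real.exp_bound' h0 h1 (n := 3) (by norm_num)
  rw [show (3 : ℕ) = 1 + 1 + 1 from rfl] at h
  repeat rw [Finset.sum_range_succ] at h
  norm_num [Nat.factorial] at h
  unfold expUB
  nlinarith [h]

/-- `expUB` is monotone on the nonnegative reals (a larger pad gives a larger bound). [folklore] -/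
theorem expUB_mono {x y : ℝ} (hx : 0 ≤ x) (hxy : x ≤ y) : expUB x ≤ expUB y := by
  unfold expUB
  have h2 : x ^ 2 ≤ y ^ 2 := by nlinarith
  have h3 : x ^ 3 ≤ y ^ 3 := by nlinarith
  nlinarith

/-- `1 ≤ expUB x` for `0 ≤ x`. [folklore] -/
theorem one_le_expUB {x : ℝ} (hx : 0 ≤ x) : 1 ≤ expUB x := by
  unfold expUB
  have h2 : 0 ≤ x ^ 2 := by positivity
  have h3 : 0 ≤ x ^ 3 := by positivity
  linarith

/-! ## §2 The decisions in closed form -/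

/-- **THE (b)-MARGIN DECISION, upper guard, closed form.** `X = exp ∘ f` with `|f'| ≤ S`
(`0 ≤ S`) on `(a, b)`, `a ≤ b`, pad exponent `S (b - a)/2 ≤ 1`, end values `X(a) ≤ h₁`,
`X(b) ≤ h₂`, and the RATIONAL test `max h₁ h₂ · expUB (S (b - a)/2) < θ` ⇒ `X(u) < θ` on `[a, b]`.
[folklore] -/
theorem exp_lt_on_Icc_of_expUB_test {f f' : ℝ → ℝ} {a b S u h₁ h₂ θ : ℝ}
    (hcont : ContinuousOn f (Icc a b)) (hder : ∀ x ∈ Ioo a b, HasDerivAt f (f' x) x)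
    (hS : ∀ x ∈ Ioo a b, |f' x| ≤ S) (hS0 : 0 ≤ S) (hab : a ≤ b)
    (hx1 : S * ((b - a) / 2) ≤ 1) (ha : Real.exp (f a) ≤ h₁) (hb : Real.exp (f b) ≤ h₂)
    (htest : max h₁ h₂ * expUB (S * ((b - a) / 2)) < θ) (hu : u ∈ Icc a b) :
    Real.exp (f u) < θ := by
  have hx0 : 0 ≤ S * ((b - a) / 2) := mul_nonneg hS0 (by linarith)
  have hh : 0 ≤ max h₁ h₂ := ((Real.exp_pos (f a)).le.trans ha).trans (le_max_left _ _)
  exact exp_lt_on_Icc_of_padded_hull_lt hcont hder hS hS0 ha hb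
    ((mul_le_mul_of_nonneg_left (exp_le_expUB hx0 hx1) hh).trans_lt htest) hu

/-- **THE ONE-SIDED GUARD DECISION, upper guard, closed form** (§P.12(c′)(iii)-BY-GUARD):
`X(a) ≤ h`, `|f'| ≤ S` on `(a, b)`, `S (b - a) ≤ 1`, and `h · expUB (S (b - a)) < θ` ⇒ `X(u) < θ`
on the reach `[a, b]`. [folklore] -/
theorem exp_lt_on_Icc_of_expUB_end_test {f f' : ℝ → ℝ} {a b S u h θ : ℝ}
    (hcont : ContinuousOn f (Icc a b)) (hder : ∀ x ∈ Ioo a b, HasDerivAt f (f' x) x)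
    (hS : ∀ x ∈ Ioo a b, |f' x| ≤ S) (hS0 : 0 ≤ S) (hab : a ≤ b) (hx1 : S * (b - a) ≤ 1)
    (ha : Real.exp (f a) ≤ h) (htest : h * expUB (S * (b - a)) < θ) (hu : u ∈ Icc a b) :
    Real.exp (f u) < θ := by
  have hx0 : 0 ≤ S * (b - a) := mul_nonneg hS0 (by linarith)
  have hh : 0 ≤ h := (Real.exp_pos (f a)).le.trans ha
  exact exp_lt_on_Icc_of_padded_end_lt hcont hder hS hS0 ha
    ((mul_le_mul_of_nonneg_left (exp_le_expUB hx0 hx1) hh).trans_lt htest) hu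

/-- **THE (b)-MARGIN DECISION, lower guard, linear form**: `l₁ ≤ X(a)`, `l₂ ≤ X(b)` (`0 < l₁`,
`0 < l₂`), `|f'| ≤ S` on `(a, b)`, and `θ < min l₁ l₂ · (1 - S (b - a)/2)` ⇒ `θ < X(u)` on
`[a, b]` (`1 - x ≤ e^{-x}`). [folklore] -/
theorem lt_exp_on_Icc_of_linear_test {f f' : ℝ → ℝ} {a b S u l₁ l₂ θ : ℝ}
    (hcont : ContinuousOn f (Icc a b)) (hder : ∀ x ∈ Ioo a b, HasDerivAt f (f' x) x)
    (hS : ∀ x ∈ Ioo a b, |f' x| ≤ S) (hS0 : 0 ≤ S) (hl₁ : 0 < l₁) (hl₂ : 0 < l₂)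
    (ha : l₁ ≤ Real.exp (f a)) (hb : l₂ ≤ Real.exp (f b))
    (htest : θ < min l₁ l₂ * (1 - S * ((b - a) / 2))) (hu : u ∈ Icc a b) :
    θ < Real.exp (f u) := by
  have hl : 0 ≤ min l₁ l₂ := (lt_min hl₁ hl₂).le
  exact lt_exp_on_Icc_of_lt_padded_hull hcont hder hS hS0 hl₁ hl₂ ha hb
    (htest.trans_le (mul_le_mul_of_nonneg_left
      (by have := Real.add_one_le_exp (-(S * ((b - a) / 2))); linarith) hl)) hu

/-! ## §3 Kernel-checked margins of the P-INTERVALS rows of record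

Inputs per row (`router/P-INTERVALS.tsv`, records `runs/<material>/P*/descriptors_*.json`): the R3c
guard `r_man,hi` at the two computed pressures, the class sensitivity `S_(U/t) = 12/5`, and
`L = |ln(V_i/V_j)|` from the record volumes rounded up to three decimals; threshold `θ_c3 = 3/5`.
A `_test` theorem is the exact form of a «decided by margin» sentence; a `_test_fails` theorem is
the exact form of an «undetermined by margin» sentence (it certifies only that THIS test withholds
the word). -/

/-- **Lu M101 (88,174), fcc-parent pair: DECIDED** — `max 0.27 0.21 · expUB (1.2 · 0.209) < 0.6`
(P-INTERVALS v0.23 «0.27 × e^(1.2·0.209) = 0.35 < 0.6»). [folklore] -/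
theorem lu_88_174_test :
    max (27 / 100 : ℝ) (21 / 100) * expUB ((12 / 5) * ((209 / 1000) / 2)) < 3 / 5 := by
  rw [max_eq_left (by norm_num)]; unfold expUB; norm_num

/-- Lu (88,174) read on the dhcp-main / fcc pair (`r_man,hi` 0.32 / 0.21, `L = 0.211`): also
decided. [folklore] -/
theorem lu_88_174_dhcp_test :
    max (32 / 100 : ℝ) (21 / 100) * expUB ((12 / 5) * ((211 / 1000) / 2)) < 3 / 5 := by
  rw [max_eq_left (by norm_num)]; unfold expUB; norm_num

/-- **Lu M101 (0.8,22): the margin test FAILS** — `max 0.50 0.39 · expUB (1.2 · 0.307) ≥ 0.6`;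
indeed already the lower bound `0.50 · (1 + 1.2·0.307) ≥ 0.6` fails the window (P-INTERVALS v0.23
«0.50 × e^(1.2·0.307) = 0.72 ≥ 0.6 ⇒ undetermined»). [folklore] -/
theorem lu_0p8_22_test_fails :
    ¬ max (50 / 100 : ℝ) (39 / 100) * expUB ((12 / 5) * ((307 / 1000) / 2)) < 3 / 5 := by
  rw [max_eq_left (by norm_num)]; unfold expUB; norm_num

/-- The failure is not an artefact of the cubic bound: with the TRUE exponential the padded hull
already exceeds the threshold, since `e^x ≥ 1 + x` gives `0.50 · (1 + 0.3684) = 0.684 ≥ 0.6`.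
[folklore] -/
theorem lu_0p8_22_padded_hull_ge :
    (3 / 5 : ℝ) ≤ 50 / 100 * Real.exp ((12 / 5) * ((307 / 1000) / 2)) := by
  have h := Real.add_one_le_exp ((12 / 5 : ℝ) * ((307 / 1000) / 2))
  nlinarith [h]

/-- **Lu M101 (22,88): the margin test FAILS on the leg hull** (`r_man,hi` 0.43 Sm / 0.32 dhcp,
`L = 0.356`): `0.43 · e^(0.427) ≥ 0.43 · 1.427 = 0.61 ≥ 0.6`. [folklore] -/
theorem lu_22_88_padded_hull_ge :
    (3 / 5 : ℝ) ≤ 43 / 100 * Real.exp ((12 / 5) * ((356 / 1000) / 2)) := by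
  have h := Real.add_one_le_exp ((12 / 5 : ℝ) * ((356 / 1000) / 2))
  nlinarith [h]

/-- **V M102 (30,60): DECIDED** (`r_man,hi` 0.45 / 0.40; record L = 0.096; P-INTERVALS v0.13
«0.45 × e^(1.2·0.096) = 0.505 < 0.6»). [folklore] -/
theorem v_30_60_test :
    max (45 / 100 : ℝ) (40 / 100) * expUB ((12 / 5) * ((96 / 1000) / 2)) < 3 / 5 := by
  rw [max_eq_left (by norm_num)]; unfold expUB; norm_num

/-- **V M102 (0,30): the margin test FAILS** (`r_man,hi` 0.55 / 0.45, record L = 0.146):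
`0.55 · (1 + 0.1752) = 0.646 ≥ 0.6` already (P-INTERVALS v0.13 «0.55 × e^(1.2·0.146) = 0.66»).
[folklore] -/
theorem v_0_30_padded_hull_ge :
    (3 / 5 : ℝ) ≤ 55 / 100 * Real.exp ((12 / 5) * ((146 / 1000) / 2)) := by
  have h := Real.add_one_le_exp ((12 / 5 : ℝ) * ((146 / 1000) / 2))
  nlinarith [h]

/-- **GRID-CURE PRE-REGISTRATION (lead R-dq), V (0,10)**: on the pre-registered inputs
(`r_man,hi` 0.55 @0, 0.52 expected @10; Vinet class `L(0,10) = 0.056`) the test PASSES —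
`0.55 · expUB (0.0672) < 0.6` (pre-registered decimal 0.588). When the @10 record lands only the
inputs can differ. [folklore] -/
theorem v_0_10_prereg_test :
    max (55 / 100 : ℝ) (52 / 100) * expUB ((12 / 5) * ((56 / 1000) / 2)) < 3 / 5 := by
  rw [max_eq_left (by norm_num)]; unfold expUB; norm_num

/-- **GRID-CURE PRE-REGISTRATION, Lu (0.8,6)** (`r_man,hi` 0.50 @0.8, ≤ 0.50 expected @6; Vinet
class `L(0.8,6) = 0.113`): the test PASSES — `0.50 · expUB (0.1356) < 0.6` (pre-registered 0.57).
[folklore] -/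
theorem lu_0p8_6_prereg_test :
    max (50 / 100 : ℝ) (50 / 100) * expUB ((12 / 5) * ((113 / 1000) / 2)) < 3 / 5 := by
  rw [max_eq_left (by norm_num)]; unfold expUB; norm_num

/-! ### Rows of record added after the first landing (append-only; one line per «decided by margin» row) -/

/-- **fcc-YH₃ M230 (130,170): DECIDED** (box #132, lead 2026-08-27T11:56:12Z; `r_man,hi` 0.13 / 0.12,
`L ≤ 0.090` = the outer bound over Kong 2021's by-sample cells 83.6–84.5 → 77.3–78.8 ų, rounded up):
`0.13 · expUB (1.2 · 0.090) < 0.6` (P-INTERVALS v0.25 «0.145 ≪ θ_c3»). [folklore] -/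
theorem yh3_130_170_test :
    max (13 / 100 : ℝ) (12 / 100) * expUB ((12 / 5) * ((90 / 1000) / 2)) < 3 / 5 := by
  rw [max_eq_left (by norm_num)]; unfold expUB; norm_num

/-- **YBa₂Cu₄O₈ (Y-124) M199 (0,10): DECIDED on the LOWER guard** (box #138 stage 1, lead
2026-08-27T12:21:05Z; R3a `r₁,lo` 0.929 @0 / 1.004 @10 vs `θ_hi = 0.6`, cuprate class `S_(U/t) = 1.7`,
`L = 0.075`): the linear lower-guard test of `lt_exp_on_Icc_of_linear_test`,
`0.6 < min 0.929 1.004 · (1 − 1.7 · 0.075 / 2)` (= 0.870; P-INTERVALS v0.26 «1BH+3BE — interpolated», the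
eighth cuprate/nickelate Hubbard-token interval word). [folklore] -/
theorem y124_0_10_lower_test :
    (3 / 5 : ℝ) < min (929 / 1000) (1004 / 1000) * (1 - (17 / 10) * ((75 / 1000) / 2)) := by
  rw [min_eq_left (by norm_num)]; norm_num

/-- **Lu₄H₂₃ M184 (181,218): DECIDED ROBUSTLY IN THE SPACING** (box #145, lead 2026-08-27T13:40:54Z;
R3c on Lu `r_man,hi` 0.44 @181 / 0.47 @218). The two record cells are different MEMBERS (printed
185-GPa cell vs PBE vc-relax at 218), so the record-pair `|ln V₁/V₂| = 0.041` is not the physical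
spacing; the word is certified for EVERY spacing `L ≤ 1/5` (> 3× the clathrate-hydride class value
≈ 0.063 over 37 GPa): `0.47 · expUB (1.2 · 0.2) = 0.598 < 0.6`; smaller `L` pass by `expUB_mono`
(P-INTERVALS v0.33 «EPH — interpolated (P.12e)», break-even `L = 0.203`). [folklore] -/
theorem lu4h23_181_218_test :
    max (47 / 100 : ℝ) (44 / 100) * expUB ((12 / 5) * ((1 / 5) / 2)) < 3 / 5 := by
  rw [max_eq_left (by norm_num)]; unfold expUB; norm_num

/-- … and the same test at any smaller nonnegative spacing. [folklore] -/
theorem lu4h23_181_218_test_of_le {L : ℝ} (h0 : 0 ≤ L) (hL : L ≤ 1 / 5) :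
    max (47 / 100 : ℝ) (44 / 100) * expUB ((12 / 5) * (L / 2)) < 3 / 5 := by
  have hx : (12 / 5 : ℝ) * (L / 2) ≤ (12 / 5) * ((1 / 5) / 2) := by nlinarith
  have h := mul_le_mul_of_nonneg_left (expUB_mono (by positivity) hx)
    (show (0 : ℝ) ≤ max (47 / 100) (44 / 100) by norm_num)
  exact h.trans_lt lu4h23_181_218_test

/-! ## §4 The TWO-END (tent) form of the (b)-margin test — sharper under the same premises

The (b) test pads the HULL of the two end values from the nearer end: `max h₁ h₂ · e^{S L/2}`. Both
one-sided mean-value bounds hold at once — `ln X(u) ≤ ln h₁ + S (u - a)` and `≤ ln h₂ + S (b - u)` —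
and their SUM gives `2 ln X(u) ≤ ln h₁ + ln h₂ + S L`, i.e. `X(u)² ≤ h₁ h₂ e^{S L}`: the geometric
mean of the end values replaces their maximum. Closed form: `h₁ · h₂ · expUB (S L) < θ²` ⇒ `X < θ`
on the whole sub-interval (`S L ≤ 1`). It is never weaker than (b) (`h₁ h₂ ≤ (max h₁ h₂)²` and
`e^{S L} = (e^{S L/2})²`), and strictly sharper whenever `h₁ ≠ h₂`. A PROPOSED reading «(b♯)» for
`router/INFLATION-RULES.md` §P.12 (the rule text defines the word-issuing test; the lead dates it). -/

/-- **TWO-END BOUND (squared form).** `X = exp ∘ f`, `|f'| ≤ S` on `(a, b)`, `X(a) ≤ h₁`,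
`X(b) ≤ h₂` ⇒ `X(u)² ≤ h₁ · h₂ · e^{S (b - a)}` for every `u ∈ [a, b]`. [folklore] -/
theorem exp_sq_le_on_Icc_of_abs_deriv_le {f f' : ℝ → ℝ} {a b S u h₁ h₂ : ℝ}
    (hcont : ContinuousOn f (Icc a b)) (hder : ∀ x ∈ Ioo a b, HasDerivAt f (f' x) x)
    (hS : ∀ x ∈ Ioo a b, |f' x| ≤ S) (ha : Real.exp (f a) ≤ h₁) (hb : Real.exp (f b) ≤ h₂)
    (hu : u ∈ Icc a b) : Real.exp (f u) ^ 2 ≤ h₁ * h₂ * Real.exp (S * (b - a)) := by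
  obtain ⟨-, r₁⟩ := mem_Icc_of_abs_deriv_le_left hcont hder hS
    (show f a ∈ Icc (f a) (f a) from ⟨le_rfl, le_rfl⟩) hu
  obtain ⟨-, r₂⟩ := mem_Icc_of_abs_deriv_le_right hcont hder hS
    (show f b ∈ Icc (f b) (f b) from ⟨le_rfl, le_rfl⟩) hu
  have hsum : 2 * f u ≤ f a + f b + S * (b - a) := by linarith
  have h1 : Real.exp (f u) ^ 2 = Real.exp (2 * f u) := by
    rw [← Real.exp_nat_mul]; norm_num
  have h2 : Real.exp (2 * f u) ≤ Real.exp (f a) * Real.exp (f b) * Real.exp (S * (b - a)) := by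
    rw [← Real.exp_add, ← Real.exp_add]; exact Real.exp_le_exp.2 hsum
  have hfa : 0 ≤ Real.exp (f a) := (Real.exp_pos _).le
  have hfb : 0 ≤ Real.exp (f b) := (Real.exp_pos _).le
  have hE : 0 ≤ Real.exp (S * (b - a)) := (Real.exp_pos _).le
  calc Real.exp (f u) ^ 2 = Real.exp (2 * f u) := h1
    _ ≤ Real.exp (f a) * Real.exp (f b) * Real.exp (S * (b - a)) := h2
    _ ≤ h₁ * h₂ * Real.exp (S * (b - a)) := by
        have := mul_le_mul ha hb hfb ((Real.exp_pos _).le.trans ha)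
        exact mul_le_mul_of_nonneg_right this hE

/-- **THE (b♯) TWO-END DECISION, upper guard, closed form**: `S (b - a) ≤ 1`, `0 < θ` and the
rational test `h₁ · h₂ · expUB (S (b - a)) < θ²` ⇒ `X(u) < θ` on `[a, b]`. [folklore] -/
theorem exp_lt_on_Icc_of_tent_test {f f' : ℝ → ℝ} {a b S u h₁ h₂ θ : ℝ}
    (hcont : ContinuousOn f (Icc a b)) (hder : ∀ x ∈ Ioo a b, HasDerivAt f (f' x) x)
    (hS : ∀ x ∈ Ioo a b, |f' x| ≤ S) (hS0 : 0 ≤ S) (hab : a ≤ b) (hx1 : S * (b - a) ≤ 1)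
    (ha : Real.exp (f a) ≤ h₁) (hb : Real.exp (f b) ≤ h₂) (hθ : 0 < θ)
    (htest : h₁ * h₂ * expUB (S * (b - a)) < θ ^ 2) (hu : u ∈ Icc a b) :
    Real.exp (f u) < θ := by
  have hx0 : 0 ≤ S * (b - a) := mul_nonneg hS0 (by linarith)
  have hh : 0 ≤ h₁ * h₂ := mul_nonneg ((Real.exp_pos _).le.trans ha) ((Real.exp_pos _).le.trans hb)
  have hsq : Real.exp (f u) ^ 2 < θ ^ 2 :=
    ((exp_sq_le_on_Icc_of_abs_deriv_le hcont hder hS ha hb hu).trans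
      (mul_le_mul_of_nonneg_left (exp_le_expUB hx0 hx1) hh)).trans_lt htest
  exact lt_of_pow_lt_pow_left₀ 2 hθ.le hsq

/-- **(b♯) IS NEVER WEAKER THAN (b)**: if the max-form test passes, the tent test passes
(`h₁ h₂ ≤ (max h₁ h₂)²`; with `E = e^{S L/2}` the max-form bound squared is `max² · E²`).
[folklore] -/
theorem tent_le_maxForm_sq {h₁ h₂ E : ℝ} (h1 : 0 ≤ h₁) (h2 : 0 ≤ h₂) :
    h₁ * h₂ * E ^ 2 ≤ (max h₁ h₂ * E) ^ 2 := by
  have hm1 : h₁ ≤ max h₁ h₂ := le_max_left _ _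
  have hm2 : h₂ ≤ max h₁ h₂ := le_max_right _ _
  have : h₁ * h₂ ≤ max h₁ h₂ * max h₁ h₂ := mul_le_mul hm1 hm2 h2 (h1.trans hm1)
  nlinarith [sq_nonneg E]

/-- **THE (b♯) TWO-END DECISION, lower guard, linear form**: `l₁ ≤ X(a)`, `l₂ ≤ X(b)` (`0 < l₁`,
`0 < l₂`), `|f'| ≤ S` and `θ² < l₁ · l₂ · (1 - S (b - a))` ⇒ `θ < X(u)` on `[a, b]` (any real `θ`)
(`X(u)² ≥ l₁ l₂ e^{-S L} ≥ l₁ l₂ (1 - S L)`). [folklore] -/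
theorem lt_exp_on_Icc_of_tent_lower_test {f f' : ℝ → ℝ} {a b S u l₁ l₂ θ : ℝ}
    (hcont : ContinuousOn f (Icc a b)) (hder : ∀ x ∈ Ioo a b, HasDerivAt f (f' x) x)
    (hS : ∀ x ∈ Ioo a b, |f' x| ≤ S) (hl₁ : 0 < l₁) (hl₂ : 0 < l₂)
    (ha : l₁ ≤ Real.exp (f a)) (hb : l₂ ≤ Real.exp (f b))
    (htest : θ ^ 2 < l₁ * l₂ * (1 - S * (b - a))) (hu : u ∈ Icc a b) :
    θ < Real.exp (f u) := by
  obtain ⟨r₁, -⟩ := mem_Icc_of_abs_deriv_le_left hcont hder hS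
    (show f a ∈ Icc (f a) (f a) from ⟨le_rfl, le_rfl⟩) hu
  obtain ⟨r₂, -⟩ := mem_Icc_of_abs_deriv_le_right hcont hder hS
    (show f b ∈ Icc (f b) (f b) from ⟨le_rfl, le_rfl⟩) hu
  have hsum : f a + f b - S * (b - a) ≤ 2 * f u := by linarith
  have hla : Real.log l₁ ≤ f a := by rw [← Real.log_exp (f a)]; exact Real.log_le_log hl₁ ha
  have hlb : Real.log l₂ ≤ f b := by rw [← Real.log_exp (f b)]; exact Real.log_le_log hl₂ hb
  have hlow : l₁ * l₂ * Real.exp (-(S * (b - a))) ≤ Real.exp (f u) ^ 2 := by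
    have : Real.exp (Real.log l₁ + Real.log l₂ + -(S * (b - a))) ≤ Real.exp (2 * f u) :=
      Real.exp_le_exp.2 (by linarith)
    rw [Real.exp_add, Real.exp_add, Real.exp_log hl₁, Real.exp_log hl₂] at this
    rwa [← Real.exp_nat_mul, Nat.cast_ofNat]
  have hlin : l₁ * l₂ * (1 - S * (b - a)) ≤ l₁ * l₂ * Real.exp (-(S * (b - a))) :=
    mul_le_mul_of_nonneg_left (by have := Real.add_one_le_exp (-(S * (b - a))); linarith)
      (mul_pos hl₁ hl₂).le
  have hsq : θ ^ 2 < Real.exp (f u) ^ 2 := htest.trans_le (hlin.trans hlow)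
  exact lt_of_pow_lt_pow_left₀ 2 (Real.exp_pos _).le hsq

/-- **V M102 (0,30) under (b♯): STILL WITHHELD on the record pair** (`r_man,hi` 0.55 @0 / 0.45 @30;
record volumes 13.827 → 11.809 ų/atom ⇒ `L = 0.158`): `0.55 · 0.45 · expUB (2.4 · 0.158) ≥ 0.36`
(= 0.3621; the tent test misses by 0.002 — on the Murnaghan class value `L = 0.146` it would pass,
`v_0_30_tent_test_classL`, which is why the record pair, the sound input, is the one of record).
[folklore] -/
theorem v_0_30_tent_test_fails :
    ¬ (55 / 100 : ℝ) * (45 / 100) * expUB ((12 / 5) * (158 / 1000)) < (3 / 5) ^ 2 := by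
  unfold expUB; norm_num

/-- … while on the Murnaghan-class spacing 0.146 the tent test passes (0.3518 < 0.36) — recorded to
show the decision is input-limited, not method-limited. [folklore] -/
theorem v_0_30_tent_test_classL :
    (55 / 100 : ℝ) * (45 / 100) * expUB ((12 / 5) * (146 / 1000)) < (3 / 5) ^ 2 := by
  unfold expUB; norm_num

/-- **Lu M101 (22,88) under (b♯): the MARGIN arm passes** (`r_man,hi` 0.43 Sm / 0.32 dhcp, `L = 0.356`:
`0.43 · 0.32 · expUB (2.4 · 0.356) = 0.33 < 0.36`) — but the row stays «undetermined» by §P.12(h)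
(Sm-type → dhcp structure entry inside), which no margin test can lift. [folklore] -/
theorem lu_22_88_tent_test :
    (43 / 100 : ℝ) * (32 / 100) * expUB ((12 / 5) * (356 / 1000)) < (3 / 5) ^ 2 := by
  unfold expUB; norm_num

/-! ## §5 Withheld-by-margin instances found by the self-replay (router.py r44 `hull`, 2026-08-27T15:03Z)

A LOWER-guard word («… ≥ θ» decided at both ends) is withheld on the interval as soon as the padded
lower hull `l_min · e^{-S L/2}` CAN fall below `θ`; since `e^{-x} ≤ 1/(1 + x)`, the rational test
`l_min < θ · (1 + S L/2)` certifies the withholding (the generic `e^{-x} ≤ 1/(1+x)` is the tree's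
`Literature.Probability.LatticeModels.SixVertex.exp_neg_le_one_div_add`; inlined here to keep the
import light). -/

/-- **FeSe M26 (0,4): WITHHELD on the lower guard** — the «UND:MULTIORB(k=5; J_H)» head rests on
R3c arm (ii) `r_man,lo ≥ θ_c3 = 0.6` with `r_man,lo` 0.65 @0 / 0.62 @4; with `L = 0.1135`, `S = 2.4`
the padded lower hull `0.62 · e^{-0.136} ≤ 0.62/(1.136) < 0.6` (P-INTERVALS v0.35 self-replay
correction: «interpolated» → «undetermined»). [folklore] -/
theorem fese_0_4_padded_lower_lt :
    (62 / 100 : ℝ) * Real.exp (-((12 / 5) * ((1135 / 10000) / 2))) < 3 / 5 := by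
  have hx : (0 : ℝ) < 1 + (12 / 5) * ((1135 / 10000) / 2) := by norm_num
  have h : Real.exp (-((12 / 5) * ((1135 / 10000) / 2))) ≤ 1 / (1 + (12 / 5) * ((1135 / 10000) / 2)) := by
    rw [Real.exp_neg, ← one_div]
    exact one_div_le_one_div_of_le hx (by have := Real.add_one_le_exp (((12 / 5) * ((1135 / 10000) / 2) : ℝ)); linarith)
  have h2 : (62 / 100 : ℝ) * (1 / (1 + (12 / 5) * ((1135 / 10000) / 2))) < 3 / 5 := by norm_num
  exact (mul_le_mul_of_nonneg_left h (by norm_num)).trans_lt h2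

/-- **FeSe M26 (4,8): WITHHELD on the lower guard** — `r_man,lo` 0.62 @4 / 0.61 @8, `L = 0.0549`:
`0.61 · e^{-0.0659} ≤ 0.61/1.0659 < 0.6`. [folklore] -/
theorem fese_4_8_padded_lower_lt :
    (61 / 100 : ℝ) * Real.exp (-((12 / 5) * ((549 / 10000) / 2))) < 3 / 5 := by
  have hx : (0 : ℝ) < 1 + (12 / 5) * ((549 / 10000) / 2) := by norm_num
  have h : Real.exp (-((12 / 5) * ((549 / 10000) / 2))) ≤ 1 / (1 + (12 / 5) * ((549 / 10000) / 2)) := by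
    rw [Real.exp_neg, ← one_div]
    exact one_div_le_one_div_of_le hx (by have := Real.add_one_le_exp (((12 / 5) * ((549 / 10000) / 2) : ℝ)); linarith)
  have h2 : (61 / 100 : ℝ) * (1 / (1 + (12 / 5) * ((549 / 10000) / 2))) < 3 / 5 := by norm_num
  exact (mul_le_mul_of_nonneg_left h (by norm_num)).trans_lt h2

/-! ## §6 Y-124 (M199) re-read on the STAGE-2 records (box #138 v2, 2026-08-27T18:22Z)

Stage 2 prints `r₁ = U₁/W₁` hulls `[0.678, 1.608]` @0 / `[0.641, 1.516]` @10 (stage-1 values of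
`y124_0_10_lower_test` are context only). (0,10) is decided on the LOWER guard `r₁ ≥ 3/5` by the §4
tent sentence with the measured cuprate `S_(U/t) = 1.7` and the largest spacing by source `L = 0.075`;
the min-form passes by `1.4e-4`; the placeholder `S = 2.4` would fail — stated (P-INTERVALS v0.39). -/

/-- **Y-124 M199 (0,10), STAGE 2: the tent lower test PASSES** —
`θ_hi² = 0.36 < 0.678 · 0.641 · (1 - 1.7 · 0.075) = 0.3792` (premise `htest` of
`lt_exp_on_Icc_of_tent_lower_test`). [folklore] -/
theorem y124v2_0_10_tent_lower_test :
    (3 / 5 : ℝ) ^ 2 < 678 / 1000 * (641 / 1000) * (1 - 17 / 10 * (75 / 1000)) := by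
  norm_num

/-- … and the superseded min-form passes only just (`0.60014`). [folklore] -/
theorem y124v2_0_10_lower_test :
    (3 / 5 : ℝ) < min (678 / 1000) (641 / 1000) * (1 - 17 / 10 * ((75 / 1000) / 2)) := by
  rw [min_eq_right (by norm_num)]; norm_num

/-- **SENSITIVITY STATED**: with the one-band PLACEHOLDER `S = 2.4` the tent test FAILS (`0.3564 <
0.36`) — the decision rests on the measured class `S_(U/t) = 1.7` (break-even `2.29`). [folklore] -/
theorem y124v2_0_10_tent_fails_at_placeholder_S :
    ¬ ((3 / 5 : ℝ) ^ 2 < 678 / 1000 * (641 / 1000) * (1 - 12 / 5 * (75 / 1000))) := by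
  norm_num

/-- … while on the spacing it is robust: the tent passes for every `L ≤ 1/10`. [folklore] -/
theorem y124v2_0_10_tent_lower_test_of_le {L : ℝ} (hL : L ≤ 1 / 10) :
    (3 / 5 : ℝ) ^ 2 < 678 / 1000 * (641 / 1000) * (1 - 17 / 10 * L) := by
  nlinarith

end Inflation

end Summit.Ventures.CertifiedManyBodySolver.Downfold
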